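import Mathlib.Algebra.Polynomial.SpecificDegree
import Literature.NumberTheory.GaloisRepresentations.GaloisCohomologyKummerProofs
import Literature.NumberTheory.GaloisRepresentations.AbsGaloisGroup
import HarnessLib

/-!
# The stabiliser of a root of `X³ − X − 1`: a normal subgroup of index `3` of `Γ_E` fixing no
# primitive cube root of unity (cell `b2b-bsdres`, team n1011, seat p10 GEN 8; row T-VIS3-UC, FILE 4;
# note `HOME/b2b-bsdres-n1011-p10/g8/L41-NOTE.md` §3, skeleton `cells/n1011/skel/T-VIS3-UC.md`)

HONEST FRAMING (cell `b2b-bsdres`, run/shared/lean/b2b/bsd-rank1-residual/, verbatim in every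
file): the goal of the cell is to DELETE the COMBINATION-SHAPED residual classes of the
Birch–Swinnerton-Dyer formula for ALL analytic-rank `≤ 1` elliptic curves over `ℚ` — "full BSD
formula for every rank `≤ 1` curve in class `C`" assembled STRICTLY from published theorems — so
that the rank-`≤ 1` remainder becomes exactly the CONSTRUCTION-SHAPED classes, which are TYPED
(missing-input `Prop`s), NOT attempted. This is not "finishing BSD". Team n1011 (N10 / N11):
research route on the CONSTRUCTION-SHAPED class X4 (§I N11 LOWER half); no claim beyond the stated
classes; nothing is booked; marks UNCHANGED. Theorems only: no definition, no named fact, no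
`sorry`. TOOL theorems of pure field theory; they close nothing by themselves.

## What

The record shape `TwistedWitness.exists_sha_ne_zero_of_congr_of_twistedDivisible_of_rootsOfUnity`
(FILE 3) needs, at the hard place `v₀`, a normal subgroup `H ⊴ Γ = Γ_{K_{v₀}}` of index `p`, an
element `F ∉ H`, and "no primitive `p`-th root of unity is fixed by `H`". Over `ℚ` at `p = 3` the
intended `H` is `Γ_M` for `M = ℚ₃(α)`, `α³ = α + 1`, the UNRAMIFIED CUBIC extension. This file
produces `H`, `F` and the roots-of-unity statement for ANY field `E` of characteristic `0` from
three decidable facts about `E` (for `E = ℚ₃`: `−23` is a square, `X³ − X − 1` has no root, `−3` is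
not a square — the T-LOC3L / `PadicSquareClass` currency), with NO local field theory, NO Hensel
lemma and NO degree count:

* `H = Stab_Γ(α)` for a root `α ∈ K̄_E` of `X³ − X − 1`. With `δ ∈ E`, `δ² = −23`, the other two
  roots are the EXPLICIT elements `r± = (−α ± δ/(3α² − 1))/2` of `E(α)` (the discriminant of
  `X³ − X − 1` is `−23`; `(3α² − 1)²(3α² − 4) = 23`), so every `σ ∈ Γ` maps `α` into
  `{α, r₊, r₋}` (factorisation `X³ − X − 1 = (X − α)(X − r₊)(X − r₋)`), every `h ∈ H` fixes all
  three, and `H` is NORMAL (`normal_stabilizer_cubicRoot`).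
* If `X³ − X − 1` has no root in `E` it is irreducible (degree `3`), it is the minimal polynomial of
  `α`, and `Γ` is transitive on its roots (Mathlib `minpoly.exists_algEquiv_of_root'`): some
  `F ∈ Γ` has `F α = r₊ ≠ α`, and `[Γ : H] = #Γα = #{α, r₊, r₋} = 3`
  (`exists_smul_cubicRoot_ne`, `index_stabilizer_cubicRoot`).
* If `−3` is not a square in `E`, no primitive cube root of unity `ζ ∈ K̄_E` is fixed by `H`
  (`exists_mem_stabilizer_smul_ne_of_cube_eq_one`): `w = 2ζ + 1` has `w² = −3`, its orbit is
  `{w, −w}` with `−w` attained (`w ∉ E`, tree `absoluteGaloisGroup.exists_algebraMap_eq_pow_of_forall_smul_eq`),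
  so `Stab(w)` has index `2`; `H ≤ Stab(w)` would give `2 ∣ 3`.

References: elementary Galois theory (e.g. [Lang, *Algebra*, VI §2: the Galois group of a cubic
lies in `A₃` iff the discriminant is a square]); Mathlib `FieldTheory.Normal.Basic`,
`GroupTheory.Index`.
-/

noncomputable section

open scoped Classical

namespace Summit.BirchSwinnertonDyer.Rank1Residual.GaloisImage.TwistedWitness

open Field Polynomial Literature.NumberTheory.GaloisRepresentations

section Cubic

variable (E : Type) [Field E] [CharZero E]

/-- A root of `X³ − X − 1` exists in `K̄_E`. [folklore] -/
theorem exists_cubicRoot : ∃ α : AlgebraicClosure E, α ^ 3 = α + 1 := by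
  have hd : (X ^ 3 - X - 1 : (AlgebraicClosure E)[X]).degree = 3 := by compute_degree!
  obtain ⟨α, hα⟩ := IsAlgClosed.exists_root (X ^ 3 - X - 1 : (AlgebraicClosure E)[X])
    (by rw [hd]; norm_num)
  refine ⟨α, ?_⟩
  simp only [IsRoot, eval_sub, eval_pow, eval_X, eval_one] at hα
  linear_combination hα

variable {E}
variable {α : AlgebraicClosure E} (hα : α ^ 3 = α + 1) {δ : E} (hδ : δ ^ 2 = -23)
include hα

omit [CharZero E] in
/-- `(3α² − 1)²(3α² − 4) = 23` for a root `α` of `X³ − X − 1` (the discriminant is `−23`).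
[folklore] -/
theorem cubicRoot_key : (3 * α ^ 2 - 1) ^ 2 * (3 * α ^ 2 - 4) = 23 := by
  linear_combination (27 * (α ^ 3 - α + 1)) * hα

/-- `3α² − 1 ≠ 0` (`f'(α) ≠ 0`: the roots are simple in characteristic `0`). [folklore] -/
theorem cubicRoot_deriv_ne_zero : 3 * α ^ 2 - 1 ≠ 0 := by
  intro h
  have := cubicRoot_key hα
  rw [h] at this
  norm_num at this

include hδ

/-- With `s = δ/(3α² − 1)`: `s² = 4 − 3α²`. [folklore] -/
theorem cubicRoot_s_sq :
    (algebraMap E (AlgebraicClosure E) δ / (3 * α ^ 2 - 1)) ^ 2 = 4 - 3 * α ^ 2 := by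
  have hne := cubicRoot_deriv_ne_zero hα
  have hδ' : (algebraMap E (AlgebraicClosure E) δ) ^ 2 = -23 := by
    rw [← map_pow, hδ, map_neg, map_ofNat]
  have hkey := cubicRoot_key hα
  rw [div_pow, hδ', div_eq_iff (pow_ne_zero 2 hne)]
  linear_combination hkey

/-- **The factorisation** `x³ − x − 1 = (x − α)(x − r₊)(x − r₋)` with
`r± = (−α ± δ/(3α² − 1))/2 ∈ E(α)`. [folklore] -/
theorem cubic_factor (x : AlgebraicClosure E) :
    x ^ 3 - x - 1 =
      (x - α) * (x - (-α + algebraMap E (AlgebraicClosure E) δ / (3 * α ^ 2 - 1)) / 2) *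
        (x - (-α - algebraMap E (AlgebraicClosure E) δ / (3 * α ^ 2 - 1)) / 2) := by
  have hs := cubicRoot_s_sq hα hδ
  set s := algebraMap E (AlgebraicClosure E) δ / (3 * α ^ 2 - 1)
  linear_combination hα + ((x - α) / 4) * hs

/-- Every `σ ∈ Γ_E` maps `α` to one of the three roots `α, r₊, r₋`. [folklore] -/
theorem smul_cubicRoot_mem (σ : absoluteGaloisGroup E) :
    σ • α = α ∨ σ • α = (-α + algebraMap E (AlgebraicClosure E) δ / (3 * α ^ 2 - 1)) / 2 ∨
      σ • α = (-α - algebraMap E (AlgebraicClosure E) δ / (3 * α ^ 2 - 1)) / 2 := by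
  have hroot : (σ • α) ^ 3 - σ • α - 1 = 0 := by
    rw [absoluteGaloisGroup.smul_def, ← map_pow, ← map_sub, ← map_one (absoluteGaloisGroup.toAlgEquiv E σ),
      ← map_sub, sub_sub, ← hα]
    simp
  rw [cubic_factor hα hδ (σ • α), mul_eq_zero, mul_eq_zero, sub_eq_zero, sub_eq_zero, sub_eq_zero] at hroot
  tauto

omit hα hδ in
/-- An element fixing `α` fixes `r₊` and `r₋` (they lie in `E(α)`). [folklore] -/
theorem smul_root_eq_of_smul_eq {h : absoluteGaloisGroup E} (hh : h • α = α) (ε : E) :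
    h • ((-α + algebraMap E (AlgebraicClosure E) ε * (algebraMap E (AlgebraicClosure E) δ /
      (3 * α ^ 2 - 1))) / 2) =
      (-α + algebraMap E (AlgebraicClosure E) ε * (algebraMap E (AlgebraicClosure E) δ /
        (3 * α ^ 2 - 1))) / 2 := by
  rw [absoluteGaloisGroup.smul_def] at hh ⊢
  set τ := absoluteGaloisGroup.toAlgEquiv E h
  have h2 : τ 2 = 2 := map_ofNat τ 2
  have h3 : τ 3 = 3 := map_ofNat τ 3
  rw [map_div₀, map_add, map_neg, hh, map_mul, AlgEquiv.commutes, map_div₀, AlgEquiv.commutes,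
    map_sub, map_mul, h3, map_pow, hh, map_one, h2]

/-- **`Stab(α)` is a normal subgroup of `Γ_E`.** [folklore] -/
theorem normal_stabilizer_cubicRoot :
    (MulAction.stabilizer (absoluteGaloisGroup E) α).Normal := by
  refine ⟨fun h hh g ↦ ?_⟩
  rw [MulAction.mem_stabilizer_iff] at hh ⊢
  rw [mul_smul, mul_smul]
  -- `g⁻¹ • α` is a root, fixed by `h`
  have hfix : h • (g⁻¹ • α) = g⁻¹ • α := by
    rcases smul_cubicRoot_mem hα hδ g⁻¹ with e | e | e
    · rw [e, hh]
    · rw [e]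
      have := smul_root_eq_of_smul_eq (δ := δ) hh 1
      simpa using this
    · rw [e]
      have := smul_root_eq_of_smul_eq (δ := δ) hh (-1)
      simpa [sub_eq_add_neg] using this
  rw [hfix, smul_inv_smul]

/-- The three roots are distinct: `α ≠ r₊`, `α ≠ r₋`, `r₊ ≠ r₋`. [folklore] -/
theorem cubicRoots_ne :
    α ≠ (-α + algebraMap E (AlgebraicClosure E) δ / (3 * α ^ 2 - 1)) / 2 ∧
    α ≠ (-α - algebraMap E (AlgebraicClosure E) δ / (3 * α ^ 2 - 1)) / 2 ∧
    (-α + algebraMap E (AlgebraicClosure E) δ / (3 * α ^ 2 - 1)) / 2 ≠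
      (-α - algebraMap E (AlgebraicClosure E) δ / (3 * α ^ 2 - 1)) / 2 := by
  have hne := cubicRoot_deriv_ne_zero hα
  have hs := cubicRoot_s_sq hα hδ
  set s := algebraMap E (AlgebraicClosure E) δ / (3 * α ^ 2 - 1) with hsdef
  have hs0 : s ≠ 0 := by
    rw [hsdef]
    refine div_ne_zero ?_ hne
    intro h0
    have : (algebraMap E (AlgebraicClosure E) δ) ^ 2 = -23 := by rw [← map_pow, hδ, map_neg, map_ofNat]
    rw [h0] at this
    norm_num at this
  -- `(α − r₊)(α − r₋) = 3α² − 1 ≠ 0`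
  have hprod : (α - (-α + s) / 2) * (α - (-α - s) / 2) = 3 * α ^ 2 - 1 := by
    linear_combination (-(1 : AlgebraicClosure E) / 4) * hs
  refine ⟨fun e ↦ hne ?_, fun e ↦ hne ?_, fun e ↦ hs0 ?_⟩
  · rw [← hprod, ← e, sub_self, zero_mul]
  · rw [← hprod, ← e, sub_self, mul_zero]
  · linear_combination e

variable (hnoroot : ∀ x : E, x ^ 3 - x - 1 ≠ 0)
include hnoroot

omit hδ in
/-- If `X³ − X − 1` has no root in `E`, it is the minimal polynomial of `α` over `E`. [folklore] -/
theorem minpoly_cubicRoot : minpoly E α = X ^ 3 - X - 1 := by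
  have hdeg : (X ^ 3 - X - 1 : E[X]).natDegree = 3 := by compute_degree!
  have hmonic : (X ^ 3 - X - 1 : E[X]).Monic := by monicity!
  refine (minpoly.eq_of_irreducible_of_monic ?_ ?_ hmonic).symm
  · refine Polynomial.irreducible_of_degree_le_three_of_not_isRoot (by rw [hdeg]; decide)
      fun x hx ↦ hnoroot x ?_
    simpa [IsRoot, eval_sub, eval_pow, eval_X, eval_one] using hx
  · simp only [map_sub, map_pow, aeval_X, map_one]
    linear_combination hα

/-- **Transitivity**: some `F ∈ Γ_E` maps `α` to `r₊` (and likewise to `r₋`). [folklore] -/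
theorem exists_smul_cubicRoot_eq (ε : E) (hε : ε = 1 ∨ ε = -1) :
    ∃ F : absoluteGaloisGroup E,
      F • α = (-α + algebraMap E (AlgebraicClosure E) ε * (algebraMap E (AlgebraicClosure E) δ /
        (3 * α ^ 2 - 1))) / 2 := by
  haveI : Normal E (AlgebraicClosure E) := IsAlgClosure.normal E (AlgebraicClosure E)
  set r := (-α + algebraMap E (AlgebraicClosure E) ε * (algebraMap E (AlgebraicClosure E) δ /
        (3 * α ^ 2 - 1))) / 2 with hr
  have hroot : r ^ 3 - r - 1 = 0 := by
    rw [cubic_factor hα hδ r, mul_eq_zero, mul_eq_zero]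
    rcases hε with rfl | rfl
    · left; right; rw [hr]; simp
    · right; rw [hr]; simp [sub_eq_add_neg]
  have hev : aeval r (minpoly E α) = 0 := by
    rw [minpoly_cubicRoot hα hnoroot]
    simp only [map_sub, map_pow, aeval_X, map_one]
    exact hroot
  obtain ⟨σ, hσ⟩ := minpoly.exists_algEquiv_of_root' (Algebra.IsAlgebraic.isAlgebraic α) hev
  exact ⟨(absoluteGaloisGroup.toAlgEquiv E).symm σ, by
    rw [absoluteGaloisGroup.toAlgEquiv_symm_apply]; exact hσ⟩

/-- **Some `F ∈ Γ_E` moves `α`** (so `F ∉ Stab(α)`). [folklore] -/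
theorem exists_smul_cubicRoot_ne : ∃ F : absoluteGaloisGroup E,
    F ∉ MulAction.stabilizer (absoluteGaloisGroup E) α := by
  obtain ⟨F, hF⟩ := exists_smul_cubicRoot_eq hα hδ hnoroot 1 (Or.inl rfl)
  refine ⟨F, fun hmem ↦ (cubicRoots_ne hα hδ).1 ?_⟩
  rw [MulAction.mem_stabilizer_iff] at hmem
  rw [hmem] at hF
  simpa using hF

/-- **`[Γ_E : Stab(α)] = 3`**: the orbit of `α` is `{α, r₊, r₋}`. [folklore] -/
theorem index_stabilizer_cubicRoot :
    (MulAction.stabilizer (absoluteGaloisGroup E) α).index = 3 := by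
  obtain ⟨hne1, hne2, hne3⟩ := cubicRoots_ne hα hδ
  rw [MulAction.index_stabilizer, Set.ncard_eq_three]
  refine ⟨α, _, _, hne1, hne2, hne3, ?_⟩
  ext x
  rw [MulAction.mem_orbit_iff]
  simp only [Set.mem_insert_iff, Set.mem_singleton_iff]
  constructor
  · rintro ⟨σ, rfl⟩
    exact smul_cubicRoot_mem hα hδ σ
  · rintro (rfl | rfl | rfl)
    · exact ⟨1, one_smul _ _⟩
    · obtain ⟨F, hF⟩ := exists_smul_cubicRoot_eq hα hδ hnoroot 1 (Or.inl rfl)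
      exact ⟨F, by simpa using hF⟩
    · obtain ⟨F, hF⟩ := exists_smul_cubicRoot_eq hα hδ hnoroot (-1) (Or.inr rfl)
      exact ⟨F, by simpa [sub_eq_add_neg] using hF⟩

omit hnoroot in
/-- **No primitive cube root of unity is fixed by `Stab(α)`** when `−3` is not a square in `E`
(and `X³ − X − 1` has no root in `E`): `w = 2ζ + 1` has `w² = −3`, orbit `{w, −w}` of size `2`, and
`Stab(α) ≤ Stab(w)` would force `2 ∣ [Γ : Stab(α)] = 3`. [folklore] -/
theorem exists_mem_stabilizer_smul_ne_of_cube_eq_one (hnoroot : ∀ x : E, x ^ 3 - x - 1 ≠ 0)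
    (h3 : ∀ y : E, y ^ 2 ≠ -3) (ζ : AlgebraicClosure E) (hζ : ζ ^ 3 = 1) (hζ1 : ζ ≠ 1) :
    ∃ h ∈ MulAction.stabilizer (absoluteGaloisGroup E) α, h • ζ ≠ ζ := by
  by_contra hall
  push Not at hall
  -- `w = 2ζ + 1`, `w² = −3`
  set w : AlgebraicClosure E := 2 * ζ + 1 with hwdef
  have hζ2 : ζ ^ 2 + ζ + 1 = 0 := by
    have h0 : (ζ - 1) * (ζ ^ 2 + ζ + 1) = 0 := by linear_combination hζ
    rcases mul_eq_zero.mp h0 with h | h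
    · exact absurd (sub_eq_zero.mp h) hζ1
    · exact h
  have hw2 : w ^ 2 = -3 := by rw [hwdef]; linear_combination (4 : AlgebraicClosure E) * hζ2
  have hw0 : w ≠ 0 := fun h0 ↦ by rw [h0] at hw2; norm_num at hw2
  have hwne : w ≠ -w := fun e ↦ hw0 (by linear_combination e / 2)
  -- `Stab(α) ≤ Stab(w)`
  have hle : MulAction.stabilizer (absoluteGaloisGroup E) α ≤
      MulAction.stabilizer (absoluteGaloisGroup E) w := fun h hh ↦ by
    rw [MulAction.mem_stabilizer_iff, hwdef, smul_add, smul_mul', hall h hh, smul_one,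
      absoluteGaloisGroup.smul_def, map_ofNat]
  -- the orbit of `w` is `{w, −w}`
  have hsq : ∀ σ : absoluteGaloisGroup E, σ • w = w ∨ σ • w = -w := fun σ ↦ by
    have h1 : (σ • w) ^ 2 = -3 := by
      rw [← smul_pow', hw2, smul_neg, absoluteGaloisGroup.smul_def, map_ofNat]
    have h2 : (σ • w - w) * (σ • w + w) = 0 := by linear_combination h1 - hw2
    rcases mul_eq_zero.mp h2 with h | h
    · exact Or.inl (sub_eq_zero.mp h)
    · exact Or.inr (eq_neg_of_add_eq_zero_left h)
  have hmoved : ∃ σ₀ : absoluteGaloisGroup E, σ₀ • w ≠ w := by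
    by_contra hfix
    push Not at hfix
    haveI : ExpChar E 1 := ExpChar.zero
    obtain ⟨m, y, hy⟩ := absoluteGaloisGroup.exists_algebraMap_eq_pow_of_forall_smul_eq E 1
      (x := w) hfix
    rw [one_pow, pow_one] at hy
    apply h3 y
    apply (algebraMap E (AlgebraicClosure E)).injective
    rw [map_pow, hy, hw2, map_neg, map_ofNat]
  obtain ⟨σ₀, hσ₀⟩ := hmoved
  have horbit : MulAction.orbit (absoluteGaloisGroup E) w = {w, -w} := by
    ext x
    rw [MulAction.mem_orbit_iff]
    simp only [Set.mem_insert_iff, Set.mem_singleton_iff]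
    constructor
    · rintro ⟨σ, rfl⟩; exact hsq σ
    · rintro (rfl | rfl)
      · exact ⟨1, one_smul _ _⟩
      · exact ⟨σ₀, (hsq σ₀).resolve_left hσ₀⟩
  have hidx : (MulAction.stabilizer (absoluteGaloisGroup E) w).index = 2 := by
    rw [MulAction.index_stabilizer, horbit, Set.ncard_pair hwne]
  have hdvd := Subgroup.index_dvd_of_le hle
  rw [hidx, index_stabilizer_cubicRoot hα hδ hnoroot] at hdvd
  norm_num at hdvd

end Cubic

end Summit.BirchSwinnertonDyer.Rank1Residual.GaloisImage.TwistedWitness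

end
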